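import Literature.Computability.Cryptography.CenteredBinomialMLWE
import HarnessLib

/-!
# The MLWE and MSIS advantages of ML-DSA (Dilithium)

Topic `Computability/Cryptography`. The two average-case lattice assumptions of CRYSTALS-Dilithium /
ML-DSA, verbatim from the designers' document (Bai et al., CRYSTALS-Dilithium specification v3.1,
§6.1 "Assumptions"):

* "The MLWE Problem. For integers `m, k`, and a probability distribution `D : R_q → [0,1]`, we say
  that the advantage of algorithm `A` in solving the decisional `MLWE_{m,k,D}` problem over the ring
  `R_q` is `Adv^MLWE_{m,k,D} := |Pr[b = 1 | A ← R_q^{m×k}; t ← R_q^m; b ← A(A, t)] −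
  Pr[b = 1 | A ← R_q^{m×k}; s₁ ← D^k; s₂ ← D^m; b ← A(A, A s₁ + s₂)]|`."
* "The MSIS Problem. To an algorithm `A` we associate the advantage function `Adv^MSIS_{m,k,γ}` to
  solve the (Hermite Normal Form) `MSIS_{m,k,γ}` problem over the ring `R_q` as
  `Adv^MSIS_{m,k,γ}(A) := Pr[0 < ‖y‖_∞ ≤ γ ∧ [I | A]·y = 0 | A ← R_q^{m×k}; y ← A(A)]`."

with `‖·‖_∞` the centred-representative sup norm (§2.1 "Sizes of elements": "For an element
`w ∈ ℤ_q`, we write `‖w‖_∞` to mean `|w mod± q|` … `‖w‖_∞ = max_i ‖w_i‖_∞`" over the coefficients and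
over the entries of a vector) and `S_η` "all elements `w ∈ R` such that `‖w‖_∞ ≤ η`" (§2.1), the secret
distribution of the scheme being "`D` a uniform distribution over `S_η`" (§6.2, eq. (6)). These are the
quantities in the KLS18 bound quoted there: `Adv^{SUF-CMA}_Dilithium(A) ≤ Adv^MLWE_{k,ℓ,D}(B) +
Adv^{SelfTargetMSIS}_{H,k,ℓ+1,ζ}(C) + Adv^MSIS_{k,ℓ,ζ'}(D) + 2^{−254}` (`SelfTargetMSIS` involves the hash
`H` and is not formalised here).

## Contents

* `RingLWE.mlweSamplesWith D k m`, `RingLWE.mlweAdvantageWith D k m A` — `MLWE_{m,k,D}` for an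
  arbitrary secret/error law `D` on `R_q` (generic `K`, `q`); `binomialMLWESamples_eq` identifies the
  Kyber game of `CenteredBinomialMLWE.lean` as the case `D = D_η(R_q)`.
* `RingLWE.coeffSupNorm b q x` — `‖x‖_∞` via centred representatives of the `b`-coordinates;
  `RingLWE.uniformEta b q η` — the uniform distribution on `S_η` (coefficient-wise uniform on
  `{−η, …, η}`).
* `RingLWE.MSIS.IsSolution`, `RingLWE.msisAdvantage` — HNF-`MSIS_{m,k,γ}`.
* `MLDSA.q = 8380417`, `MLDSA.mlweAdvantage`, `MLDSA.msisAdvantage` — the instance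
  `R_q = ℤ_q[X]/(X^256 + 1)` = `𝓞(ℚ(ζ_512)) ⧸ (q)` with the power basis (FIPS 204 §4 Table 1).

## Design

* The sign convention `|Pr[uniform] − Pr[real]|` vs `|Pr[real] − Pr[uniform]|` is immaterial
  (absolute value); we keep the tree's `real − uniform` order (`LWE.distinguishingAdvantage`).
* `[I | A]·y = 0` with `y = (y₁, y₂) ∈ R_q^m × R_q^k` reads `y₁ + A y₂ = 0`.
* Secret law uniform on `S_η`: i.i.d. coordinates uniform on `{−η,…,η}` in the basis `b`, realised as
  `Fin (2η+1)` shifted by `−η` and pushed through `RingLWE.ofIntCoords`.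

## References

* S. Bai et al., *CRYSTALS-Dilithium: Algorithm specifications and supporting documentation*
  (Version 3.1, 2021-02-08): §2.1 (mod±, ‖·‖_∞, S_η), §6.1 (MLWE, MSIS, SelfTargetMSIS), §6.2 eq. (6),
  Tables 1–3. [BaiEtAl2021DilithiumSpec]
* NIST FIPS 204, *Module-Lattice-Based Digital Signature Standard* (Aug. 2024): §4 Table 1
  (`q = 8380417`, `(k,ℓ)`, `η`). [NISTFIPS204]
* A. Langlois, D. Stehlé, DCC 75 (2015), §3 (M-SIS), Def. 4.6 (M-LWE). [LangloisStehle2014]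
-/

noncomputable section

open scoped ENNReal NumberField
open NumberField

namespace Literature.Computability.Cryptography

namespace RingLWE

variable {K : Type} [Field K] [NumberField K] {n : ℕ} (b : Module.Basis (Fin n) ℤ (𝓞 K))
  (q : ℕ) [NeZero q]

/-! ### `MLWE_{m,k,D}` for an arbitrary short distribution `D` -/

variable {q} in
/-- The MLWE branch of `MLWE_{m,k,D}`: `s₁ ← D^k`, then the `m` rows of `(A, A s₁ + s₂)`,
`A ← R_q^{m×k}`, `s₂ ← D^m` — i.e. `LWE.lweSamples D s₁ m` averaged over `s₁ ← D^k` (Dilithium spec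
§6.1 "The MLWE Problem"). [cite: BaiEtAl2021DilithiumSpec, §6.1 (MLWE)] -/
def mlweSamplesWith (D : PMF (Rq K q)) (k m : ℕ) : PMF (Fin m → (Fin k → Rq K q) × Rq K q) :=
  (LWE.iidPMF D k).bind fun s ↦ LWE.lweSamples D s m

variable {q} in
/-- `Adv^MLWE_{m,k,D}(A)` (Dilithium spec §6.1, verbatim in the module docstring): the absolute
difference of `A`'s acceptance probabilities on `(A, A s₁ + s₂)` and on `(A, t)`, `t ← R_q^m`.
[cite: BaiEtAl2021DilithiumSpec, §6.1 (MLWE)] -/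
def mlweAdvantageWith (D : PMF (Rq K q)) (k m : ℕ) (Adv : LWE.Distinguisher (Fin k) (Rq K q) m) : ℝ :=
  |(LWE.acceptProb Adv (mlweSamplesWith D k m)).toReal -
    (LWE.acceptProb Adv (LWE.uniformSamples (Fin k) (Rq K q) m)).toReal|

/-- Kyber's game is `MLWE_{m,k,D}` at `D = D_η(R_q)` (definitionally).
[cite: BaiEtAl2021DilithiumSpec, §6.1 (MLWE)] -/
theorem binomialMLWESamples_eq (k η m : ℕ) :
    binomialMLWESamples b q k η m = mlweSamplesWith (binomialRq b q η) k m := rfl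

/-! ### Sup norm, `S_η`, and `MSIS_{m,k,γ}` -/

/-- `‖x‖_∞` for `x ∈ R_q`: the maximum over the `b`-coordinates of `|x_i mod± q|` (centred
representative `ZMod.valMinAbs`; Dilithium spec §2.1: "For an element `w ∈ ℤ_q`, we write `‖w‖_∞` to
mean `|w mod± q|` … `‖w‖_∞ = max_i ‖w_i‖_∞`"). Value in `ℕ`; `0` for `n = 0`.
[cite: BaiEtAl2021DilithiumSpec, §2.1 (Sizes of elements)] -/
def coeffSupNorm (x : Rq K q) : ℕ :=
  Finset.univ.sup fun i ↦ (ZMod.valMinAbs (rqCoords b q x i)).natAbs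

/-- The uniform distribution on `S_η = {w ∈ R : ‖w‖_∞ ≤ η}` reduced mod `q`: each `b`-coordinate
independent and uniform on `{−η, …, η}` (Dilithium spec §2.1 `S_η`; §6.2: "`D` a uniform distribution
over `S_η`"; FIPS 204 Table 1 "η - private key range"). [cite: BaiEtAl2021DilithiumSpec, §2.1 (S_η) and §6.2 eq. (6)] [cite: NISTFIPS204, §4 Table 1] -/
def uniformEta (η : ℕ) : PMF (Rq K q) :=
  (LWE.iidPMF ((PMF.uniformOfFintype (Fin (2 * η + 1))).map fun j ↦ ((j : ℕ) : ℤ) - η) n).map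
    (ofIntCoords b q)

/-- `y = (y₁, y₂) ∈ R_q^m × R_q^k` **solves HNF-`MSIS_{m,k,γ}` for `A ∈ R_q^{m×k}`**:
`0 < ‖y‖_∞ ≤ γ` and `[I | A]·y = y₁ + A y₂ = 0` (Dilithium spec §6.1 "The MSIS Problem").
[cite: BaiEtAl2021DilithiumSpec, §6.1 (MSIS)] -/
def MSIS.IsSolution {m k : ℕ} (A : Matrix (Fin m) (Fin k) (Rq K q)) (γ : ℕ)
    (y : (Fin m → Rq K q) × (Fin k → Rq K q)) : Prop :=
  y ≠ 0 ∧ (∀ i, coeffSupNorm b q (y.1 i) ≤ γ) ∧ (∀ j, coeffSupNorm b q (y.2 j) ≤ γ) ∧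
    y.1 + A.mulVec y.2 = 0

/-- `Adv^MSIS_{m,k,γ}(A) = Pr[0 < ‖y‖_∞ ≤ γ ∧ [I|A]·y = 0 | A ← R_q^{m×k}; y ← A(A)]` for a
(randomised) solver `Adv` (Dilithium spec §6.1). [cite: BaiEtAl2021DilithiumSpec, §6.1 (MSIS)] -/
def msisAdvantage (m k γ : ℕ)
    (Adv : Matrix (Fin m) (Fin k) (Rq K q) → PMF ((Fin m → Rq K q) × (Fin k → Rq K q))) : ℝ≥0∞ :=
  ((PMF.uniformOfFintype (Matrix (Fin m) (Fin k) (Rq K q))).bind fun A ↦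
      (Adv A).map fun y ↦ (A, y)).toOuterMeasure {p | MSIS.IsSolution b q p.1 γ p.2}

/-- An MSIS advantage is at most `1`. [cite: BaiEtAl2021DilithiumSpec, §6.1 (MSIS)] -/
theorem msisAdvantage_le_one (m k γ : ℕ)
    (Adv : Matrix (Fin m) (Fin k) (Rq K q) → PMF ((Fin m → Rq K q) × (Fin k → Rq K q))) :
    msisAdvantage b q m k γ Adv ≤ 1 :=
  (PMF.toOuterMeasure_mono _ (Set.subset_univ _)).trans_eq
    ((PMF.toOuterMeasure_apply_eq_one_iff _ _).2 (Set.subset_univ _))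

end RingLWE

/-! ### The ML-DSA instance -/

namespace MLDSA

/-- The ML-DSA modulus `q = 8380417 = 2^23 − 2^13 + 1` (FIPS 204 §4 Table 1). [cite: NISTFIPS204, §4 Table 1] -/
def q : ℕ := 8380417

/-- `q ≠ 0`. [cite: NISTFIPS204, §4 Table 1] -/
instance : NeZero q := ⟨by decide⟩

/-- `q = 2^23 − 2^13 + 1`. [cite: NISTFIPS204, §4 Table 1] -/
theorem q_eq : q = 2 ^ 23 - 2 ^ 13 + 1 := by decide

/-- **The ML-DSA MLWE advantage** `Adv^MLWE_{k,ℓ,D}` with `D` uniform on `S_η`, over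
`R_q = ℤ_8380417[X]/(X^256 + 1) = 𝓞(ℚ(ζ_512)) ⧸ (q)` in the power basis (FIPS 204 Table 1:
`(k, ℓ) ∈ {(4,4), (6,5), (8,7)}`, `η ∈ {2, 4, 2}`; designers' challenge sets `(2,2), η = 6` and
`(3,3), η = 3`, Dilithium spec Table 3). Arguments: `k` rows (samples), `ℓ` columns (secret length),
`η`. [cite: NISTFIPS204, §4 Table 1] [cite: BaiEtAl2021DilithiumSpec, §6.1 (MLWE) and §6.2 eq. (6)] -/
def mlweAdvantage (k ℓ η : ℕ)
    (Adv : LWE.Distinguisher (Fin ℓ) (RingLWE.Rq (CyclotomicField (2 ^ 9) ℚ) q) k) : ℝ :=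
  RingLWE.mlweAdvantageWith (RingLWE.uniformEta (cyclotomicPowerBasis 9).basis q η) ℓ k Adv

/-- **The ML-DSA MSIS advantage** `Adv^MSIS_{k,ℓ,γ}` over the same ring and basis (Dilithium spec §6.1,
§6.2 eq. (6) with `γ = ζ' = max{2(γ₁ − β), 4γ₂ + 2}`). [cite: BaiEtAl2021DilithiumSpec, §6.1 (MSIS) and §6.2 eqs. (6), (8)] -/
def msisAdvantage (k ℓ γ : ℕ)
    (Adv : Matrix (Fin k) (Fin ℓ) (RingLWE.Rq (CyclotomicField (2 ^ 9) ℚ) q) →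
      PMF ((Fin k → RingLWE.Rq (CyclotomicField (2 ^ 9) ℚ) q) ×
        (Fin ℓ → RingLWE.Rq (CyclotomicField (2 ^ 9) ℚ) q))) : ℝ≥0∞ :=
  RingLWE.msisAdvantage (cyclotomicPowerBasis 9).basis q k ℓ γ Adv

end MLDSA

end Literature.Computability.Cryptography

end
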